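import Mathlib

/-!
# Sylvester's law of inertia for hermitian matrices over `ℂ` — uniqueness (cell pub-hodge-repro2, seat p3)

Tier-4 B1 (route/T4-B1-p3.md v7 ll. 33 / 41) reads Liu's «signature (p_τ, q_τ) of V ⊗_{F,τ} ℝ»
(Liu 2021, p. 107 ll. 21–23) in Sylvester's normal form; the Tier-6 kernel carries that reading as
`HasSig M p q := p + q = n ∧ ∃ P, IsUnit P.det ∧ Pᴴ M P = diag(1^p, (−1)^q)` (t6-p4, T6B1Carriers).
This file proves, Mathlib-only, that the `(p, q)` of such a normal form is an INVARIANT of `M`: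

* `card_one_eq_of_conjTranspose_mul_eq_diagonal` — the uniqueness half of **Sylvester's law of
  inertia**: if `Pᴴ M P = diagonal d` and `Qᴴ M Q = diagonal e` with `P, Q` invertible and
  `d i, e i ∈ {1, −1}`, then `#{i | d i = 1} = #{i | e i = 1}`
  (`card_neg_one_eq_of_conjTranspose_mul_eq_diagonal`: and `#{d = −1} = #{e = −1}`);
* `eq_of_conjTranspose_mul_eq_diagonal_pmVec` — on `Fin n` with `pmVec n p = diag(1^p, (−1)^{n−p})`:
  two normal forms of the same matrix have the same `p`.

Proof: on `V⁺ := span{P.col i | d i = 1}` the hermitian square `Re(vᴴ M v)` is positive definite, on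
`V⁻ := span{Q.col i | e i = −1}` it is `≤ 0`, so `V⁺ ⊓ V⁻ = ⊥` and
`#{d = 1} + #{e = −1} = dim V⁺ + dim V⁻ ≤ n = #{e = 1} + #{e = −1}`; symmetrically.
(The companion file T5HermitianInertiaSpectral identifies the count with the number of positive
eigenvalues.) Mathlib 81a5d257 has the real quadratic-form version (`QuadraticForm.sigPos`) only.
No cell import; no display; no device. §8(d): uses an L-value-free non-vanishing device: NO.
-/

namespace Summit.Ventures.HodgeRepro2.T5HermitianInertia

open Matrix Finset

variable {ι : Type*} [Fintype ι] [DecidableEq ι]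


/-- The real hermitian square `Re (vᴴ M v)` of a vector. -/
noncomputable def hsq (M : Matrix ι ι ℂ) (v : ι → ℂ) : ℝ := (star v ⬝ᵥ (M *ᵥ v)).re

omit [DecidableEq ι] in
/-- `(P c)ᴴ M (P c) = cᴴ (Pᴴ M P) c`. -/
theorem star_mulVec_dotProduct_mulVec (M P : Matrix ι ι ℂ) (c : ι → ℂ) :
    star (P *ᵥ c) ⬝ᵥ (M *ᵥ (P *ᵥ c)) = star c ⬝ᵥ ((Pᴴ * M * P) *ᵥ c) := by
  rw [star_mulVec, mulVec_mulVec, dotProduct_mulVec, vecMul_vecMul, ← dotProduct_mulVec,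
    Matrix.mul_assoc]

/-- The hermitian square of `P *ᵥ c` when `Pᴴ M P` is diagonal: `∑ᵢ Re(dᵢ) · |cᵢ|²`. -/
theorem hsq_mulVec_of_eq_diagonal {M P : Matrix ι ι ℂ} {d : ι → ℂ}
    (hPM : Pᴴ * M * P = diagonal d) (c : ι → ℂ) :
    hsq M (P *ᵥ c) = ∑ i, (d i).re * Complex.normSq (c i) := by
  unfold hsq
  rw [star_mulVec_dotProduct_mulVec, hPM]
  simp only [dotProduct, Pi.star_apply, mulVec_diagonal, Complex.re_sum]
  refine Finset.sum_congr rfl fun i _ => ?_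
  have : star (c i) * (d i * c i) = d i * (Complex.normSq (c i) : ℂ) := by
    rw [Complex.normSq_eq_conj_mul_self, Complex.star_def]; ring
  rw [this, Complex.mul_re, Complex.ofReal_re, Complex.ofReal_im, mul_zero, sub_zero]

section Subspaces

variable {M P : Matrix ι ι ℂ} {d : ι → ℂ}

/-- The coefficient vector of a combination of the columns of `P` indexed by `{i // p i}`,
extended by `0` outside `p`. -/
def extendCoeff (p : ι → Prop) [DecidablePred p] (a : {i // p i} → ℂ) : ι → ℂ :=
  fun j => if h : p j then a ⟨j, h⟩ else 0

omit [Fintype ι] [DecidableEq ι] in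
/-- `extendCoeff p a` vanishes outside `p`. -/
theorem extendCoeff_apply_of_not {p : ι → Prop} [DecidablePred p] (a : {i // p i} → ℂ) {j : ι}
    (hj : ¬ p j) : extendCoeff p a j = 0 := by
  simp [extendCoeff, hj]

omit [Fintype ι] [DecidableEq ι] in
/-- `extendCoeff p a` restricts to `a` on `p`. -/
theorem extendCoeff_apply_of {p : ι → Prop} [DecidablePred p] (a : {i // p i} → ℂ) {j : ι}
    (hj : p j) : extendCoeff p a j = a ⟨j, hj⟩ := by
  simp [extendCoeff, hj]

omit [DecidableEq ι] in
/-- `∑ᵢ aᵢ • P.col i` (over `{i // p i}`) is `P *ᵥ (extendCoeff p a)`. -/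
theorem sum_smul_col_eq_mulVec (p : ι → Prop) [DecidablePred p] (a : {i // p i} → ℂ) :
    ∑ i : {i // p i}, a i • P.col i = P *ᵥ extendCoeff p a := by
  ext j
  simp only [Finset.sum_apply, Pi.smul_apply, smul_eq_mul, Matrix.col, transpose_apply,
    mulVec, dotProduct]
  rw [← Fintype.sum_subtype_add_sum_subtype p (fun x => P j x * extendCoeff p a x)]
  have h0 : ∑ x : {x // ¬ p x}, P j x * extendCoeff p a x = 0 :=
    Finset.sum_eq_zero fun x _ => by rw [extendCoeff_apply_of_not a x.2, mul_zero]
  rw [h0, add_zero]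
  refine Finset.sum_congr rfl fun x _ => ?_
  rw [extendCoeff_apply_of a x.2, mul_comm]

omit [DecidableEq ι] in
/-- Membership in the span of the columns of `P` indexed by `p`: `v = P *ᵥ c` with `c` supported
on `p`. -/
theorem mem_span_col_iff (p : ι → Prop) [DecidablePred p] (v : ι → ℂ) :
    v ∈ Submodule.span ℂ (Set.range fun i : {i // p i} => P.col i) ↔
      ∃ c : ι → ℂ, (∀ j, ¬ p j → c j = 0) ∧ P *ᵥ c = v := by
  rw [Submodule.mem_span_range_iff_exists_fun]
  constructor
  · rintro ⟨a, ha⟩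
    exact ⟨extendCoeff p a, fun j hj => extendCoeff_apply_of_not a hj,
      by rw [← sum_smul_col_eq_mulVec]; exact ha⟩
  · rintro ⟨c, hc, rfl⟩
    refine ⟨fun i => c i, ?_⟩
    rw [sum_smul_col_eq_mulVec]
    congr 1
    ext j
    by_cases hj : p j
    · rw [extendCoeff_apply_of _ hj]
    · rw [extendCoeff_apply_of_not _ hj, hc j hj]

/-- On the span of the columns of `P` with `d = 1`, the hermitian square is `≥ 0`, and `= 0`
only at `0` (positive definiteness on `V⁺`). -/
theorem hsq_nonneg_and_eq_zero_iff_of_mem_pos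
    (hPM : Pᴴ * M * P = diagonal d) {v : ι → ℂ}
    (hv : v ∈ Submodule.span ℂ (Set.range fun i : {i // d i = 1} => P.col i)) :
    0 ≤ hsq M v ∧ (hsq M v = 0 → v = 0) := by
  obtain ⟨c, hc, rfl⟩ := (mem_span_col_iff (P := P) (fun i => d i = 1) _).1 hv
  rw [hsq_mulVec_of_eq_diagonal hPM]
  have hterm : ∀ i, (d i).re * Complex.normSq (c i) = if d i = 1 then Complex.normSq (c i) else 0 := by
    intro i
    by_cases h : d i = 1
    · simp [h]
    · simp [h, hc i h]
  have hnn : ∀ i ∈ (Finset.univ : Finset ι), 0 ≤ (d i).re * Complex.normSq (c i) := by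
    intro i _
    rw [hterm i]
    split_ifs
    · exact Complex.normSq_nonneg _
    · exact le_rfl
  refine ⟨Finset.sum_nonneg hnn, fun h0 => ?_⟩
  have hall := (Finset.sum_eq_zero_iff_of_nonneg hnn).1 h0
  have hc0 : c = 0 := by
    ext i
    by_cases h : d i = 1
    · have := hall i (Finset.mem_univ i)
      rw [hterm i, if_pos h] at this
      exact Complex.normSq_eq_zero.1 this
    · exact hc i h
  rw [hc0, mulVec_zero]

/-- On the span of the columns of `Q` with `e = −1`, the hermitian square is `≤ 0`. -/
theorem hsq_nonpos_of_mem_neg {Q : Matrix ι ι ℂ} {e : ι → ℂ}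
    (hQM : Qᴴ * M * Q = diagonal e) {v : ι → ℂ}
    (hv : v ∈ Submodule.span ℂ (Set.range fun i : {i // e i = -1} => Q.col i)) :
    hsq M v ≤ 0 := by
  obtain ⟨c, hc, rfl⟩ := (mem_span_col_iff (P := Q) (fun i => e i = -1) _).1 hv
  rw [hsq_mulVec_of_eq_diagonal hQM]
  refine Finset.sum_nonpos fun i _ => ?_
  by_cases h : e i = -1
  · simp only [h, Complex.neg_re, Complex.one_re, neg_mul, one_mul, Left.neg_nonpos_iff]
    exact Complex.normSq_nonneg _
  · rw [hc i h, map_zero, mul_zero]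

/-- The dimension of the span of the columns of an invertible `P` indexed by `p` is `#{i | p i}`. -/
theorem finrank_span_col (hP : IsUnit P.det) (p : ι → Prop) [DecidablePred p] :
    Module.finrank ℂ (Submodule.span ℂ (Set.range fun i : {i // p i} => P.col i)) =
      (Finset.univ.filter p).card := by
  have hli : LinearIndependent ℂ (fun i : {i // p i} => P.col i) :=
    (Matrix.linearIndependent_cols_iff_isUnit.2 ((Matrix.isUnit_iff_isUnit_det P).2 hP)).comp
      Subtype.val Subtype.val_injective
  rw [finrank_span_eq_card hli, Fintype.card_subtype]

end Subspaces

/-- **Sylvester's law of inertia, uniqueness (one inequality).** -/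
theorem card_one_le_of_conjTranspose_mul_eq_diagonal {M P Q : Matrix ι ι ℂ} {d e : ι → ℂ}
    (hP : IsUnit P.det) (hQ : IsUnit Q.det) (he : ∀ i, e i = 1 ∨ e i = -1)
    (hPM : Pᴴ * M * P = diagonal d) (hQM : Qᴴ * M * Q = diagonal e) :
    (Finset.univ.filter fun i => d i = 1).card ≤ (Finset.univ.filter fun i => e i = 1).card := by
  set Vp := Submodule.span ℂ (Set.range fun i : {i // d i = 1} => P.col i) with hVp
  set Vm := Submodule.span ℂ (Set.range fun i : {i // e i = -1} => Q.col i) with hVm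
  -- the two subspaces meet trivially
  have hinf : Vp ⊓ Vm = ⊥ := by
    rw [eq_bot_iff]
    intro v hv
    rw [Submodule.mem_inf] at hv
    rw [Submodule.mem_bot]
    obtain ⟨h1, h2⟩ := hsq_nonneg_and_eq_zero_iff_of_mem_pos hPM hv.1
    exact h2 (le_antisymm (hsq_nonpos_of_mem_neg hQM hv.2) h1)
  have hdim := Submodule.finrank_sup_add_finrank_inf_eq Vp Vm
  rw [hinf, finrank_bot, add_zero] at hdim
  have hle : Module.finrank ℂ ↥(Vp ⊔ Vm) ≤ Module.finrank ℂ (ι → ℂ) := Submodule.finrank_le _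
  rw [hdim, Module.finrank_fintype_fun_eq_card, hVp, hVm, finrank_span_col hP,
    finrank_span_col hQ] at hle
  -- `#{e = 1} + #{e = −1} = card ι`
  have hsplit : (Finset.univ.filter fun i => e i = 1).card +
      (Finset.univ.filter fun i => e i = -1).card = Fintype.card ι := by
    rw [← Finset.card_univ, ← Finset.card_filter_add_card_filter_not (s := Finset.univ)
      (fun i => e i = 1)]
    congr 2
    ext i
    simp only [Finset.mem_filter, Finset.mem_univ, true_and]
    rcases he i with h | h
    · rw [h]; norm_num
    · rw [h]; norm_num
  omega

/-- **Sylvester's law of inertia (uniqueness):** two diagonalisations `Pᴴ M P = diag d`,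
`Qᴴ M Q = diag e` of the same matrix into `±1` entries have the same number of `+1`'s. -/
theorem card_one_eq_of_conjTranspose_mul_eq_diagonal {M P Q : Matrix ι ι ℂ} {d e : ι → ℂ}
    (hP : IsUnit P.det) (hQ : IsUnit Q.det)
    (hd : ∀ i, d i = 1 ∨ d i = -1) (he : ∀ i, e i = 1 ∨ e i = -1)
    (hPM : Pᴴ * M * P = diagonal d) (hQM : Qᴴ * M * Q = diagonal e) :
    (Finset.univ.filter fun i => d i = 1).card = (Finset.univ.filter fun i => e i = 1).card :=
  le_antisymm (card_one_le_of_conjTranspose_mul_eq_diagonal hP hQ he hPM hQM)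
    (card_one_le_of_conjTranspose_mul_eq_diagonal hQ hP hd hQM hPM)

omit [DecidableEq ι] in
/-- The `−1` count is determined by the `+1` count. -/
theorem card_neg_one_add_card_one {d : ι → ℂ} (hd : ∀ i, d i = 1 ∨ d i = -1) :
    (Finset.univ.filter fun i => d i = 1).card +
      (Finset.univ.filter fun i => d i = -1).card = Fintype.card ι := by
  rw [← Finset.card_univ, ← Finset.card_filter_add_card_filter_not (s := Finset.univ)
    (fun i => d i = 1)]
  congr 2
  ext i
  simp only [Finset.mem_filter, Finset.mem_univ, true_and]
  rcases hd i with h | h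
  · rw [h]; norm_num
  · rw [h]; norm_num

/-- **Sylvester's law of inertia (uniqueness), negative part.** -/
theorem card_neg_one_eq_of_conjTranspose_mul_eq_diagonal {M P Q : Matrix ι ι ℂ} {d e : ι → ℂ}
    (hP : IsUnit P.det) (hQ : IsUnit Q.det)
    (hd : ∀ i, d i = 1 ∨ d i = -1) (he : ∀ i, e i = 1 ∨ e i = -1)
    (hPM : Pᴴ * M * P = diagonal d) (hQM : Qᴴ * M * Q = diagonal e) :
    (Finset.univ.filter fun i => d i = -1).card = (Finset.univ.filter fun i => e i = -1).card := by
  have h1 := card_one_eq_of_conjTranspose_mul_eq_diagonal hP hQ hd he hPM hQM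
  have h2 := card_neg_one_add_card_one hd
  have h3 := card_neg_one_add_card_one he
  omega

/-! ## The `(p, q)` of a normal form `diag(1^p, (−1)^q)` on `Fin n` -/

/-- The `±1` vector `diag(1^p, (−1)^q)` read on `Fin n`: `1` at the indices `< p`, `−1` after. -/
def pmVec (n p : ℕ) : Fin n → ℂ := fun i => if (i : ℕ) < p then 1 else -1

/-- The entries of `pmVec n p` are `1` or `−1`. -/
theorem pmVec_mem_pm (n p : ℕ) (i : Fin n) : pmVec n p i = 1 ∨ pmVec n p i = -1 := by
  unfold pmVec; split_ifs <;> simp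

/-- `pmVec n p` has exactly `p` entries equal to `1` (for `p ≤ n`). -/
theorem card_filter_pmVec_eq_one {n p : ℕ} (hp : p ≤ n) :
    (Finset.univ.filter fun i : Fin n => pmVec n p i = 1).card = p := by
  have hset : (Finset.univ.filter fun i : Fin n => pmVec n p i = 1) =
      Finset.univ.image (Fin.castLE hp) := by
    ext i
    simp only [Finset.mem_filter, Finset.mem_univ, true_and, Finset.mem_image, pmVec]
    constructor
    · intro h
      have hi : (i : ℕ) < p := by
        by_contra hcon
        rw [if_neg hcon] at h
        have := congrArg Complex.re h
        norm_num at this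
      exact ⟨⟨i, hi⟩, Fin.ext rfl⟩
    · rintro ⟨j, -, rfl⟩
      simp [Fin.castLE]
  rw [hset, Finset.card_image_of_injective _ (Fin.castLE_injective hp), Finset.card_univ,
    Fintype.card_fin]

/-- **Sylvester's law for `(p, q)`:** two normal forms `diag(1^p, (−1)^q)` and
`diag(1^{p'}, (−1)^{q'})` of the same matrix have `p = p'` (hence `q = q'` when `p + q = n = p' + q'`). -/
theorem eq_of_conjTranspose_mul_eq_diagonal_pmVec {n p p' : ℕ} {M P Q : Matrix (Fin n) (Fin n) ℂ}
    (hp : p ≤ n) (hp' : p' ≤ n) (hP : IsUnit P.det) (hQ : IsUnit Q.det)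
    (hPM : Pᴴ * M * P = diagonal (pmVec n p)) (hQM : Qᴴ * M * Q = diagonal (pmVec n p')) :
    p = p' := by
  have := card_one_eq_of_conjTranspose_mul_eq_diagonal hP hQ (pmVec_mem_pm n p) (pmVec_mem_pm n p')
    hPM hQM
  rwa [card_filter_pmVec_eq_one hp, card_filter_pmVec_eq_one hp'] at this

end Summit.Ventures.HodgeRepro2.T5HermitianInertia
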